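import Literature.NumberTheory.EllipticCurves.PastenValuationProductThm75MultiplicityProofs
import Literature.NumberTheory.EllipticCurves.PastenValuationProductThm75LeavesProofs
import Literature.NumberTheory.EllipticCurves.PastenSpectralDegreeProofs
import Literature.NumberTheory.EllipticCurves.MurtyDistinguishingIndex
import Literature.NumberTheory.EllipticCurves.CongruenceNumberLevelBound
import Literature.NumberTheory.EllipticCurves.ModularDegreeSpectralLevelBoundProofs
import Literature.NumberTheory.EllipticCurves.PastenDiscriminantBoundAbcShapeProofs
import Literature.NumberTheory.Sieve.DivisorBound
import HarnessLib

/-!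
# Murty–Pasten 2013, Thm 4.3 / Thm 7.1 (asymptotic clauses) PROVED over the tree, and the modular
# method's rung `EpsShapeBound 1` from modularity and Mazur–Kenku alone (proofs)

Topic `Literature/NumberTheory/EllipticCurves` (family `abc`, LADDER-ABC A1, the *modular method*;
cell abc-stewartyu, seat lit-abc-pasten g2). Theorems only — NO new statement, NO new named fact
(D-0026). Sources: M. R. Murty, H. Pasten, *Modular forms and effective Diophantine approximation*,
J. Number Theory **133** (2013) 3739–3754 [`MurtyPasten2013`], Thm 4.3 (p. 3748, second display:
*"Moreover, as `N → ∞` one has `log m_f ≤ log n_f ≤ (1/6) N log N + O(N log log N)`"*) and Thm 7.1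
(p. 3752, second part: *"`h_F(E) < (1/12) N log N + O(N log log N)` and
`log|Δ_E| < N log N + O(N log log N)`"*); H. Pasten, *Shimura curves and the abc conjecture*,
J. Number Theory **254** (2024) = arXiv:1705.09251 [`PastenShimura2024`], §5.4–5.6 (Prop 5.4,
Thm 5.5), §7.1 (Prop 7.1), proof of Thm 7.2 (p. 26: the Sturm-bound distinguishing index
`n_c ≤ N²(1 + log N)/6`), §3 (3.1)–(3.2).

## What this file proves

* `MurtyPasten.log_congruenceNumber_modularDegree_asymptotic_holds` — **DISCHARGE** of the named
  fact `MurtyPasten.log_congruenceNumber_modularDegree_asymptotic` (`CongruenceNumberLevelBound.lean`):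
  there are `K`, `N₀` with `log n_f ≤ (1/6) N log N + K N log log N` for the congruence number `n_f`
  of the newform of every modular parametrisation datum at level `N ≥ N₀`, and the same bound for
  `log m_f`, the optimal modular degree. UNCONDITIONAL over the tree. The printed proof (Thm 3.5:
  a covolume bound for the coprime Hecke algebra `𝕋'_N` via Hadamard, Deligne's bound and Sturm;
  Thm 4.2: `n_f ∣ i_N`) is replaced by the road the tree already has for Pasten's Thm 7.2, which
  gives the same main term `(1/6) N log N` when run with the TRIVIAL Hecke bound: `n_f` divides
  `∏_{P ≠ 𝕀_f} η_f(P)` over the minimal primes of `𝕋 = anemicHeckeRing N 2`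
  (`ModularParametrizationData.congruenceNumber_dvd_prod_heckeCongruenceModulus`, Pasten §5.6,
  PROVED), and so does `m_f = δ_{1,N}` (`PastenShimura2024_thm_5_5_holds`, PROVED via Riemann's
  period relations); each `log η_f(P) ≤ #c · log(2G)` for any bound `G` on the eigenvalues of the
  `T_p`, `p ∤ N`, `p ≤ N²(1 + log N)/6` (Sturm) — `Pasten2024.log_heckeCongruenceModulus_le_of_bound`,
  PROVED — and the trivial bound `|μ| ≤ p + 1` (`norm_eigenvalue_heckeT_gamma0_two_le`, PROVED)
  gives `log(2G) ≤ 2 log N + 2 log log N`; finally `Σ_P #c ≤ N/12 + (25/12) d(N)³ √N`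
  (`sum_finrank_quotient_minimalPrimes_le_moebius_sum`, `moebius_sum_finrank_cuspForm_two_le`:
  Atkin–Lehner count, Möbius inversion, genus formula; PROVED) and `d(N) ≪ N^{1/12}`
  (`Sieve.exists_card_divisors_le_mul_rpow'`). Net: `(N/12)(2 log N + 2 log log N) + O(N)`.
* `MurtyPasten.height_discriminant_asymptotic_of_modularity_mazurKenku` — Murty–Pasten Thm 7.1
  (asymptotic clauses, the named fact `MurtyPasten.height_discriminant_asymptotic`) from TWO named
  facts: modularity with an integral Manin constant (`nonempty_modularParametrizationData`) and the
  Mazur–Kenku comparison (`PastenShimura2024_minimalDegree_le_163_mul`); via the tree's (EqHDeg)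
  `faltingsHeight_le_of_class_bound` and (EqDiscH) `log_minimalDiscriminantNorm_le_of_modularity'`.
  (The earlier `MurtyPasten.height_discriminant_asymptotic_of_pasten` needed Pasten's Thm 7.5 in
  both halves, i.e. Murty's Lemma 11 or Murty–Sinha on top of these two.)
* `epsShapeBound_one_of_discriminant_levelBound` — any bound `log|Δ_min(E)| ≤ A · N_E log N_E` for
  all `E/ℚ` with `N_E ≥ N₀` gives `Literature.Barriers.ABC.EpsShapeBound 1` (Frey curves, as in
  `epsShapeBound_one_of_pasten_thm_7_5`, with the constant made a parameter); whence
  **`epsShapeBound_one_of_modularity_mazurKenku`** and `epsShapeBound_one_of_exists_isNewformOf_mazurKenku`: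
  the modular method's rung A1.P (`EpsShapeBound 1`, = A1.M2⁻) with trust base EXACTLY
  {Modularity Theorem, Mazur–Kenku} — no Deligne, no Murty Lemma 11, no Murty–Sinha, no Thm 7.2 fact
  (compare `epsShapeBound_one_of_modularity_of_thm_7_2`, three facts).
* Corollaries for the named fact `PastenShimura2024_thm_7_2_asymptotic` (`D = 1`):
  `PastenShimura2024_thm_7_2_asymptotic_of_murtySinha` (from the single named fact
  `murtySinha2009_eigenvalue_multiplicity_weightTwo`, by `Pasten2024.exists_log_modularDegree_lt_of_murtySinha_only`),
  `PastenShimura2024_thm_7_2_asymptotic_of_deligne_murty` (the printed road: Thm 5.5, Deligne's bound,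
  Murty's Lemma 11 `murty1999_lemma11_distinguishingIndex`, Prop 7.1), and
  `PastenShimura2024_thm_7_5_height_of_modularity_mazurKenku_murtySinha`.

WHAT THIS IS NOT: no claim on `abc`; `θ₀ = 1` rungs are weaker than the REACHED `EpsShapeBound (2/3)`
(Stewart–Yu 1991) and do not touch the `1/3` record; the constants `K`, `N₀` are not Murty–Pasten's
(their `O`-constant is not printed either).

## References

* [MurtyPasten2013] M. R. Murty, H. Pasten, J. Number Theory 133 (2013) 3739–3754: Thm 3.5
  (p. 3746), Thm 4.2, Thm 4.3 (pp. 3747–3748), Thm 7.1 (pp. 3751–3752), §8.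
* [PastenShimura2024] H. Pasten, J. Number Theory 254 (2024) 214–335 = arXiv:1705.09251: §3
  (3.1)–(3.2) p. 13, Prop 5.4, Thm 5.5, §5.6 (pp. 17–19), Prop 7.1, Thm 7.2 and its proof (p. 26).
* [DiamondShurman2005] F. Diamond, J. Shurman, GTM 228, Prop. 5.5.2(a) (the trivial Hecke bound).
-/

noncomputable section

open scoped MatrixGroups ModularForm

open WeierstrassCurve CongruenceSubgroup UpperHalfPlane

namespace Literature.NumberTheory.EllipticCurves

open ModularForms Pasten2024 DiophantineGeometry

namespace MurtyPasten

/-! ### The size of `Σ_{P ≠ 𝕀_f} log η_f(P)` from Sturm and the trivial Hecke bound -/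

/-- **`Σ_{P ≠ 𝕀_f} log η_f(P) ≤ (Σ_{P ≠ 𝕀_f} #c) · log(2G)`, `G = N²(1 + log N)/6 + 1`**, for every
modular parametrisation datum at level `N`: Pasten's Prop 5.4 at a Sturm-bound distinguishing prime
`p ≤ N²(1 + log N)/6` (`Pasten2024.log_heckeCongruenceModulus_le_of_bound`) fed with the trivial bound
`|μ| ≤ p + 1 ≤ G` for the eigenvalues of `T_p` on `S₂(Γ₀(N))` (`norm_eigenvalue_heckeT_gamma0_two_le`).
[cite: PastenShimura2024, Prop. 5.4 and proof of Thm. 7.2 (p. 26)] [cite: DiamondShurman2005, Prop. 5.5.2(a)] -/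
theorem sum_log_heckeCongruenceModulus_le_trivial {N : ℕ} [NeZero N] {W : WeierstrassCurve ℚ}
    [W.IsElliptic] (D : ModularParametrizationData W N) :
    ∑ P ∈ (finite_minimalPrimes_anemicHeckeRing N 2).toFinset.erase (eigenIdeal D.f),
        Real.log (heckeCongruenceModulus D.f P : ℝ) ≤
      (∑ P ∈ (finite_minimalPrimes_anemicHeckeRing N 2).toFinset.erase (eigenIdeal D.f),
          (Module.finrank ℤ (anemicHeckeRing N 2 ⧸ P) : ℝ)) *
        Real.log (2 * ((N : ℝ) ^ 2 * (1 + Real.log N) / 6 + 1)) := by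
  set G : ℝ := (N : ℝ) ^ 2 * (1 + Real.log N) / 6 + 1 with hG_def
  have hN1 : (1 : ℝ) ≤ N := by exact_mod_cast Nat.one_le_iff_ne_zero.mpr (NeZero.ne N)
  have hlogN : 0 ≤ Real.log N := Real.log_nonneg hN1
  have hG1 : 1 ≤ G := by
    have : 0 ≤ (N : ℝ) ^ 2 * (1 + Real.log N) / 6 := by positivity
    linarith
  have hG : ∀ (p : ℕ) [NeZero p], p.Prime → ¬ p ∣ N →
      (p : ℝ) ≤ (N : ℝ) ^ 2 * (1 + Real.log N) / 6 →
        ∀ μ : ℂ, Module.End.HasEigenvalue (heckeT (Gamma0 N) 2 p) μ → ‖μ‖ ≤ G := by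
    intro p _ hp hpN hple μ hμ
    have h := norm_eigenvalue_heckeT_gamma0_two_le (N := N) (p := p) hp hpN hμ
    linarith
  rw [Finset.sum_mul]
  refine Finset.sum_le_sum fun P hP => ?_
  exact log_heckeCongruenceModulus_le_of_bound D hG1 hG
    ((finite_minimalPrimes_anemicHeckeRing N 2).mem_toFinset.mp (Finset.mem_of_mem_erase hP))
    (Finset.ne_of_mem_erase hP)

/-- **The count `Σ_{P ≠ 𝕀_f} #c ≤ N/12 + (25/12) d(N)³ √N`** (Pasten Prop 7.1 in the crude explicit
form the tree proves: `Σ_P rank_ℤ(𝕋 ⧸ P) ≤ Σ_{ab=N} μ(a) dim S₂(Γ₀(b)) ≤ N/12 + (25/12) d(N)³ √N`,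
`sum_finrank_quotient_minimalPrimes_le_moebius_sum`, `moebius_sum_finrank_cuspForm_two_le`).
[cite: PastenShimura2024, Prop. 7.1 (p. 26)] -/
theorem sum_erase_finrank_quotient_le_explicit {N : ℕ} [NeZero N] {W : WeierstrassCurve ℚ}
    [W.IsElliptic] (D : ModularParametrizationData W N) :
    (∑ P ∈ (finite_minimalPrimes_anemicHeckeRing N 2).toFinset.erase (eigenIdeal D.f),
        (Module.finrank ℤ (anemicHeckeRing N 2 ⧸ P) : ℝ)) ≤
      (N : ℝ) / 12 + 25 / 12 * (N.divisors.card : ℝ) ^ 3 * Real.sqrt N := by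
  have h0 : (∑ P ∈ (finite_minimalPrimes_anemicHeckeRing N 2).toFinset.erase (eigenIdeal D.f),
      (Module.finrank ℤ (anemicHeckeRing N 2 ⧸ P) : ℝ)) ≤
      ((∑ P ∈ (finite_minimalPrimes_anemicHeckeRing N 2).toFinset,
          Module.finrank ℤ (anemicHeckeRing N 2 ⧸ P) : ℕ) : ℝ) := by
    rw [Nat.cast_sum]
    exact Finset.sum_le_sum_of_subset_of_nonneg (Finset.erase_subset _ _)
      fun _ _ _ => Nat.cast_nonneg _
  have h1 := sum_finrank_quotient_minimalPrimes_le_moebius_sum N 2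
  have h1' : ((∑ P ∈ (finite_minimalPrimes_anemicHeckeRing N 2).toFinset,
      Module.finrank ℤ (anemicHeckeRing N 2 ⧸ P) : ℕ) : ℝ) ≤
      (∑ x ∈ N.divisorsAntidiagonal, (ArithmeticFunction.moebius x.1 : ℤ) *
        (Module.finrank ℂ (CuspForm (Gamma0 x.2) 2) : ℤ) : ℝ) := by
    exact_mod_cast h1
  exact h0.trans (h1'.trans (moebius_sum_finrank_cuspForm_two_le N (NeZero.ne N)))

/-! ### Real-arithmetic bookkeeping -/

/-- `log log N ≥ 1` for `N ≥ 16` (`log 16 = 4 log 2 > 2.77 > e`). [folklore] -/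
private theorem one_le_log_log {N : ℕ} (hN : 16 ≤ N) : 1 ≤ Real.log (Real.log (N : ℝ)) := by
  have hN' : (16 : ℝ) ≤ N := by exact_mod_cast hN
  have hl2 := Real.log_two_gt_d9
  have he := Real.exp_one_lt_d9
  have h16 : Real.log 16 = 4 * Real.log 2 := by
    rw [show (16 : ℝ) = 2 ^ 4 by norm_num, Real.log_pow]; norm_num
  have hlog16 : Real.log 16 ≤ Real.log N := Real.log_le_log (by norm_num) hN'
  have hlogN : 0 < Real.log (N : ℝ) := by linarith
  rw [Real.le_log_iff_exp_le hlogN]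
  linarith

/-- `2 ≤ log N` for `N ≥ 16`. [folklore] -/
private theorem two_le_log {N : ℕ} (hN : 16 ≤ N) : 2 ≤ Real.log (N : ℝ) := by
  have hN' : (16 : ℝ) ≤ N := by exact_mod_cast hN
  have hl2 := Real.log_two_gt_d9
  have h16 : Real.log 16 = 4 * Real.log 2 := by
    rw [show (16 : ℝ) = 2 ^ 4 by norm_num, Real.log_pow]; norm_num
  have hlog16 : Real.log 16 ≤ Real.log N := Real.log_le_log (by norm_num) hN'
  linarith

/-- **`log(2G) ≤ 2 log N + 2 log log N`** for the trivial bound `G = N²(1 + log N)/6 + 1`, `N ≥ 16`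
(`2G ≤ N²(1 + log N) ≤ N² (log N)²`). [folklore] -/
private theorem log_two_mul_trivialBound_le {N : ℕ} (hN : 16 ≤ N) :
    Real.log (2 * ((N : ℝ) ^ 2 * (1 + Real.log N) / 6 + 1)) ≤
      2 * Real.log N + 2 * Real.log (Real.log N) := by
  have hN' : (16 : ℝ) ≤ N := by exact_mod_cast hN
  have hL := two_le_log hN
  set L : ℝ := Real.log N with hLdef
  have hNpos : (0 : ℝ) < N := by linarith
  have hLpos : 0 < L := by linarith
  have hN2 : (256 : ℝ) ≤ (N : ℝ) ^ 2 := by nlinarith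
  have h1 : 2 * ((N : ℝ) ^ 2 * (1 + L) / 6 + 1) ≤ (N : ℝ) ^ 2 * L ^ 2 := by
    have hLL : 1 + L ≤ L ^ 2 := by nlinarith
    have hA : 2 ≤ 2 / 3 * ((N : ℝ) ^ 2 * (1 + L)) := by nlinarith
    nlinarith
  have hpos : 0 < 2 * ((N : ℝ) ^ 2 * (1 + L) / 6 + 1) := by positivity
  calc Real.log (2 * ((N : ℝ) ^ 2 * (1 + L) / 6 + 1))
      ≤ Real.log ((N : ℝ) ^ 2 * L ^ 2) := Real.log_le_log hpos h1
    _ = 2 * Real.log N + 2 * Real.log L := by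
        rw [Real.log_mul (by positivity) (by positivity), Real.log_pow, Real.log_pow]
        push_cast; ring

/-- **`Σ_{P ≠ 𝕀_f} log η_f(P) ≤ (1/6) N log N + K N log log N` for `N ≥ 16`**, with an absolute `K ≥ 0`,
for every modular parametrisation datum at level `N`: `sum_log_heckeCongruenceModulus_le_trivial` ×
`sum_erase_finrank_quotient_le_explicit`, `log(2G) ≤ 2 log N + 2 log log N`, and the error term
`(25/6) d(N)³ √N (log N + log log N) ≤ 34 C³ N` by `d(N) ≤ C N^{1/12}` and `log N ≤ 4 N^{1/4}`.
This is the common size estimate behind Murty–Pasten's Thm 4.3 (asymptotic) for both `n_f` and `m_f`.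
[cite: MurtyPasten2013, Thm 4.3 (p. 3748, second display)] [cite: PastenShimura2024, proof of Thm. 7.2 (p. 26)] -/
theorem exists_sum_log_heckeCongruenceModulus_le :
    ∃ K : ℝ, 0 ≤ K ∧ ∀ (N : ℕ) [NeZero N] (W : WeierstrassCurve ℚ) [W.IsElliptic]
      (D : ModularParametrizationData W N), 16 ≤ N →
      ∑ P ∈ (finite_minimalPrimes_anemicHeckeRing N 2).toFinset.erase (eigenIdeal D.f),
          Real.log (heckeCongruenceModulus D.f P : ℝ) ≤
        (1 / 6 : ℝ) * N * Real.log N + K * N * Real.log (Real.log N) := by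
  obtain ⟨C, hC1, hC⟩ := Sieve.exists_card_divisors_le_mul_rpow' (ε := 1 / 12) (by norm_num)
  refine ⟨1 / 6 + 34 * C ^ 3, by positivity, fun N _ W _ D hN => ?_⟩
  have hN' : (16 : ℝ) ≤ N := by exact_mod_cast hN
  have hNpos : (0 : ℝ) < N := by linarith
  have hL := two_le_log hN
  have hLL := one_le_log_log hN
  set L : ℝ := Real.log N with hLdef
  set M : ℝ := Real.log L with hMdef
  -- the count and the size
  set S : ℝ := ∑ P ∈ (finite_minimalPrimes_anemicHeckeRing N 2).toFinset.erase (eigenIdeal D.f),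
      (Module.finrank ℤ (anemicHeckeRing N 2 ⧸ P) : ℝ) with hSdef
  have hS0 : 0 ≤ S := Finset.sum_nonneg fun _ _ => Nat.cast_nonneg _
  set d : ℝ := (N.divisors.card : ℝ) with hddef
  have hd0 : 0 ≤ d := Nat.cast_nonneg _
  have hST : S ≤ (N : ℝ) / 12 + 25 / 12 * d ^ 3 * Real.sqrt N :=
    sum_erase_finrank_quotient_le_explicit D
  have hsize := sum_log_heckeCongruenceModulus_le_trivial D
  have hlogG := log_two_mul_trivialBound_le hN
  have hG0 : 0 ≤ Real.log (2 * ((N : ℝ) ^ 2 * (1 + Real.log N) / 6 + 1)) := by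
    apply Real.log_nonneg
    have : 0 ≤ (N : ℝ) ^ 2 * (1 + Real.log N) / 6 := by positivity
    linarith
  -- `Σ log η ≤ T · (2 log N + 2 log log N)`
  have hT0 : 0 ≤ (N : ℝ) / 12 + 25 / 12 * d ^ 3 * Real.sqrt N := by positivity
  have hmain : ∑ P ∈ (finite_minimalPrimes_anemicHeckeRing N 2).toFinset.erase (eigenIdeal D.f),
      Real.log (heckeCongruenceModulus D.f P : ℝ) ≤
      ((N : ℝ) / 12 + 25 / 12 * d ^ 3 * Real.sqrt N) * (2 * L + 2 * M) :=
    calc _ ≤ S * Real.log (2 * ((N : ℝ) ^ 2 * (1 + Real.log N) / 6 + 1)) := hsize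
      _ ≤ ((N : ℝ) / 12 + 25 / 12 * d ^ 3 * Real.sqrt N) *
            Real.log (2 * ((N : ℝ) ^ 2 * (1 + Real.log N) / 6 + 1)) :=
          mul_le_mul_of_nonneg_right hST hG0
      _ ≤ ((N : ℝ) / 12 + 25 / 12 * d ^ 3 * Real.sqrt N) * (2 * L + 2 * M) :=
          mul_le_mul_of_nonneg_left hlogG hT0
  -- the error term `d³ √N (L + M) ≤ 8 C³ N`
  have hd : d ≤ C * (N : ℝ) ^ (1 / 12 : ℝ) := hC N
  have hq0 : 0 ≤ (N : ℝ) ^ (1 / 12 : ℝ) := by positivity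
  have hd3 : d ^ 3 ≤ C ^ 3 * (N : ℝ) ^ (1 / 4 : ℝ) := by
    have h3 : d ^ 3 ≤ (C * (N : ℝ) ^ (1 / 12 : ℝ)) ^ 3 := pow_le_pow_left₀ hd0 hd 3
    have hq : ((N : ℝ) ^ (1 / 12 : ℝ)) ^ 3 = (N : ℝ) ^ (1 / 4 : ℝ) := by
      rw [← Real.rpow_natCast, ← Real.rpow_mul hNpos.le]; norm_num
    calc d ^ 3 ≤ (C * (N : ℝ) ^ (1 / 12 : ℝ)) ^ 3 := h3
      _ = C ^ 3 * ((N : ℝ) ^ (1 / 12 : ℝ)) ^ 3 := by ring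
      _ = C ^ 3 * (N : ℝ) ^ (1 / 4 : ℝ) := by rw [hq]
  have hsqrt : Real.sqrt N = (N : ℝ) ^ (1 / 2 : ℝ) := Real.sqrt_eq_rpow _
  have hlogle : L ≤ 4 * (N : ℝ) ^ (1 / 4 : ℝ) := by
    have h := Real.log_le_rpow_div hNpos.le (show (0 : ℝ) < 1 / 4 by norm_num)
    have : (N : ℝ) ^ (1 / 4 : ℝ) / (1 / 4) = 4 * (N : ℝ) ^ (1 / 4 : ℝ) := by ring
    linarith [this ▸ h]
  have hML : M ≤ L := by
    have hLpos : 0 < L := by linarith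
    have := Real.log_le_sub_one_of_pos hLpos
    linarith
  have hrpow : (N : ℝ) ^ (1 / 4 : ℝ) * (N : ℝ) ^ (1 / 2 : ℝ) * (N : ℝ) ^ (1 / 4 : ℝ) = N := by
    rw [← Real.rpow_add hNpos, ← Real.rpow_add hNpos]; norm_num
  have hq1 : 0 ≤ (N : ℝ) ^ (1 / 4 : ℝ) := by positivity
  have hq2 : 0 ≤ (N : ℝ) ^ (1 / 2 : ℝ) := by positivity
  have hC0 : 0 ≤ C := le_trans zero_le_one hC1
  have herr : d ^ 3 * Real.sqrt N * (L + M) ≤ 8 * C ^ 3 * N := by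
    rw [hsqrt]
    have hLM : L + M ≤ 8 * (N : ℝ) ^ (1 / 4 : ℝ) := by linarith
    have hLM0 : 0 ≤ L + M := by linarith
    calc d ^ 3 * (N : ℝ) ^ (1 / 2 : ℝ) * (L + M)
        ≤ (C ^ 3 * (N : ℝ) ^ (1 / 4 : ℝ)) * (N : ℝ) ^ (1 / 2 : ℝ) * (8 * (N : ℝ) ^ (1 / 4 : ℝ)) := by
          gcongr
      _ = 8 * C ^ 3 * ((N : ℝ) ^ (1 / 4 : ℝ) * (N : ℝ) ^ (1 / 2 : ℝ) * (N : ℝ) ^ (1 / 4 : ℝ)) := by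
          ring
      _ = 8 * C ^ 3 * N := by rw [hrpow]
  -- assemble
  have hNM : (N : ℝ) ≤ N * M := by nlinarith
  calc ∑ P ∈ (finite_minimalPrimes_anemicHeckeRing N 2).toFinset.erase (eigenIdeal D.f),
        Real.log (heckeCongruenceModulus D.f P : ℝ)
      ≤ ((N : ℝ) / 12 + 25 / 12 * d ^ 3 * Real.sqrt N) * (2 * L + 2 * M) := hmain
    _ = (1 / 6 : ℝ) * N * L + (1 / 6 : ℝ) * N * M + 25 / 6 * (d ^ 3 * Real.sqrt N * (L + M)) := by
        ring
    _ ≤ (1 / 6 : ℝ) * N * L + (1 / 6 : ℝ) * N * M + 25 / 6 * (8 * C ^ 3 * N) := by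
        gcongr
    _ ≤ (1 / 6 : ℝ) * N * L + (1 / 6 : ℝ) * N * M + 34 * C ^ 3 * (N * M) := by
        nlinarith [pow_nonneg hC0 3]
    _ = (1 / 6 : ℝ) * N * L + (1 / 6 + 34 * C ^ 3) * N * M := by ring

/-! ### Murty–Pasten 2013, Thm 4.3 (asymptotic clause): DISCHARGED -/

/-- **Murty–Pasten 2013, Theorem 4.3, asymptotic clause — DISCHARGED.** There are an absolute `K`
and a threshold `N₀` such that for every modular parametrisation datum `D` at level `N ≥ N₀`:
`log n_f ≤ (1/6) N log N + K N log log N` for the congruence number `n_f` of `f = D.f`, and, if `D`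
is of minimal degree in its class (optimal), `log m_f ≤ (1/6) N log N + K N log log N` for its modular
degree. Proof over the tree (a deviation from the printed Thm 3.5/4.2 road through the index `i_N` of
the coprime Hecke algebra in its normalisation, replaced by Pasten's finer divisibilities with the
same main term): `n_f ∣ ∏_{P ≠ 𝕀_f} η_f(P)` (`congruenceNumber_dvd_prod_heckeCongruenceModulus`) and
`m_f ∣ ∏_{P ≠ 𝕀_f} η_f(P)` (`PastenShimura2024_thm_5_5_holds`), each `η_f(P) ≥ 1`, and
`Σ log η_f(P) ≤ (1/6) N log N + K N log log N` (`exists_sum_log_heckeCongruenceModulus_le`: Sturm's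
bound, the trivial Hecke bound `|a_p| ≤ p + 1`, the Atkin–Lehner/genus count of eigen-systems, the
divisor bound). Unconditional: no modularity is needed since the datum is given.
[cite: MurtyPasten2013, Thm 4.3 (p. 3748, second display)] [cite: PastenShimura2024, Thm. 5.5, §5.6 and proof of Thm. 7.2 (p. 26)] -/
theorem log_congruenceNumber_modularDegree_asymptotic_holds :
    log_congruenceNumber_modularDegree_asymptotic := by
  obtain ⟨K, hK0, hK⟩ := exists_sum_log_heckeCongruenceModulus_le
  refine ⟨K, 16, fun W _ N _ D hN => ?_⟩
  have hsum := hK N W D hN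
  -- every factor `η_f(P) ≥ 1`, so every `log η_f(P) ≥ 0`
  have hne : ∀ P ∈ (finite_minimalPrimes_anemicHeckeRing N 2).toFinset.erase (eigenIdeal D.f),
      (heckeCongruenceModulus D.f P : ℝ) ≠ 0 := fun P hP => by
    exact_mod_cast D.heckeCongruenceModulus_ne_zero
      ((finite_minimalPrimes_anemicHeckeRing N 2).mem_toFinset.mp (Finset.mem_of_mem_erase hP))
      (Finset.ne_of_mem_erase hP)
  have hlog0 : ∀ P ∈ (finite_minimalPrimes_anemicHeckeRing N 2).toFinset.erase (eigenIdeal D.f),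
      0 ≤ Real.log (heckeCongruenceModulus D.f P : ℝ) := fun P hP => by
    apply Real.log_nonneg
    have h1 : heckeCongruenceModulus D.f P ≠ 0 := by exact_mod_cast hne P hP
    exact_mod_cast Nat.one_le_iff_ne_zero.mpr h1
  have hsum0 : 0 ≤ ∑ P ∈ (finite_minimalPrimes_anemicHeckeRing N 2).toFinset.erase (eigenIdeal D.f),
      Real.log (heckeCongruenceModulus D.f P : ℝ) := Finset.sum_nonneg hlog0
  have hprodpos := D.prod_heckeCongruenceModulus_pos
  -- `log x ≤ Σ log η` whenever `x ∣ ∏ η` (including the junk case `x = 0`)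
  have key : ∀ x : ℕ, x ∣ ∏ P ∈ (finite_minimalPrimes_anemicHeckeRing N 2).toFinset.erase
      (eigenIdeal D.f), heckeCongruenceModulus D.f P →
      Real.log (x : ℝ) ≤ ∑ P ∈ (finite_minimalPrimes_anemicHeckeRing N 2).toFinset.erase
        (eigenIdeal D.f), Real.log (heckeCongruenceModulus D.f P : ℝ) := by
    intro x hx
    rcases Nat.eq_zero_or_pos x with h0 | hxpos
    · rw [h0, Nat.cast_zero, Real.log_zero]; exact hsum0
    have hle : x ≤ ∏ P ∈ (finite_minimalPrimes_anemicHeckeRing N 2).toFinset.erase (eigenIdeal D.f),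
        heckeCongruenceModulus D.f P := Nat.le_of_dvd hprodpos hx
    have hle' : (x : ℝ) ≤ ∏ P ∈ (finite_minimalPrimes_anemicHeckeRing N 2).toFinset.erase
        (eigenIdeal D.f), (heckeCongruenceModulus D.f P : ℝ) := by exact_mod_cast hle
    have hx' : (0 : ℝ) < x := by exact_mod_cast hxpos
    calc Real.log (x : ℝ) ≤ Real.log (∏ P ∈ (finite_minimalPrimes_anemicHeckeRing N 2).toFinset.erase
          (eigenIdeal D.f), (heckeCongruenceModulus D.f P : ℝ)) := Real.log_le_log hx' hle'
      _ = _ := Real.log_prod hne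
  refine ⟨(key _ D.congruenceNumber_dvd_prod_heckeCongruenceModulus).trans hsum, fun hmin => ?_⟩
  exact (key _ (PastenShimura2024_thm_5_5_holds N W D hmin)).trans hsum

end MurtyPasten

end Literature.NumberTheory.EllipticCurves

end
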